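import Literature.NumberTheory.LFunctions.GRHTwistedCharacterPrimeSumsPrimes
import Literature.NumberTheory.LFunctions.GRHSmoothEulerProductLemmas
import HarnessLib

/-!
# GRH ⇒ a Lindelöf-type bound for the partial Euler products `L(s, χ; y)`
# (Lagarias–Soundararajan 2012, Prop. 5.1)

Topic `Literature/NumberTheory/LFunctions`. THEOREMS (everything proved). For a Dirichlet
character `χ` mod `q` let `L(s, χ; y) = ∏_{p ≤ y} (1 − χ(p) p^{-s})⁻¹`
(`Literature.NumberTheory.Sieve.TwistedWeight.smoothLC`). We prove
(`smoothLC_lindelof_of_grh`): **under the Generalized Riemann Hypothesis, for every `ε > 0`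
there is `C(ε)` such that `|L(s, χ; y)| ≤ C(ε) (q(1 + |Im s|))^ε` for all `q ≥ 1`, all
NON-PRINCIPAL `χ` mod `q`, all `y` and all `s` with `Re s ≥ 1/2 + ε`** — Lagarias–Soundararajan,
*Counting smooth solutions to the equation `A + B = C`*, Proc. LMS 104 (2012), Prop. 5.1 (there
for primitive `χ`; the imprimitive factor `∏_{p ∣ q}(1 + p^{-1/2}) ≪_ε q^ε` is absorbed here,
`GRHSmoothEulerProduct.sum_primeFactors_rpow_le`, file `GRHSmoothEulerProductLemmas.lean`).

Proof: `log |L(s, χ; y)| ≤ |∑_{p ≤ y} χ(p) p^{-s}| + 12 ∑_p p^{-2σ}`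
(`GRHSmoothEulerProduct.norm_smoothLC_le_exp`, from `|(1 − z)⁻¹| ≤ exp(Re z + 12|z|²)` for
`|z| ≤ 3/4`); pass to the
primitive character `χ⋆` mod `d ∣ q` inducing `χ` at cost `∑_{p ∣ q} p^{-1/2} ≤ (ε/4) log q + P_ε`;
split `∑_{p ≤ y} χ⋆(p) p^{-s}` at a CONSTANT `U = U(ε)`: the primes `≤ U` contribute `≤ U + 1`,
and by the twisted GRH bound `|∑_{p ≤ N} χ⋆(p) p^{-it}| ≤ B √N log(d(|t|+2)N)`
(`GRHTwistedPrimeSum.exists_norm_twistedPi_le`, from the PROVED explicit formula MV Thm. 12.10)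
and partial summation (`GRHTwistedPrimeSum.norm_sum_Ioc_prime_mul_rpow_le`) the primes `> U`
contribute `≤ B log(d(|t|+2)) U^{-ε}(2 + 2/ε) + O_ε(1) ≤ (ε/4) log(q(|t|+2)) + O_ε(1)`. Hence
`log|L| ≤ (ε/2) log(q(|t|+2)) + O_ε(1)` and `|L| ≪_ε (q(1+|t|))^ε`. (No splitting at
`(log q(|t|+2))²` as in the source is needed for this `ε`-form.)

## References

* J. C. Lagarias, K. Soundararajan, *Counting smooth solutions to the equation A + B = C*,
  Proc. London Math. Soc. (3) 104 (2012), 770–798, Prop. 5.1. [LagariasSoundararajan2012]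
* H. L. Montgomery, R. C. Vaughan, *Multiplicative Number Theory I. Classical Theory*, CUP 2007,
  §13.1–13.2. [MontgomeryVaughan2007]
-/

noncomputable section

open Complex Filter Topology Set Finset
open scoped Real

namespace Literature.NumberTheory.LFunctions

namespace GRHSmoothEulerProduct

open DirichletCharacter GRHTwistedPrimeSum
open Literature.NumberTheory.Sieve.TwistedWeight (smoothLC)

/-! ### The theorem -/

/-- **GRH ⇒ Lindelöf-type bound for `L(s, χ; y)` (Lagarias–Soundararajan 2012, Prop. 5.1).**
Assume the Generalized Riemann Hypothesis. For every `ε > 0` there is `C > 0` such that for every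
`q ≠ 0`, every non-principal Dirichlet character `χ` mod `q`, every `y : ℕ` and every `s` with
`Re s ≥ 1/2 + ε`, `‖L(s, χ; y)‖ = ‖∏_{p ≤ y} (1 − χ(p)p^{-s})⁻¹‖ ≤ C (q(1 + |Im s|))^ε`.
[cite: LagariasSoundararajan2012, Prop. 5.1] -/
theorem smoothLC_lindelof_of_grh (hGRH : GeneralizedRiemannHypothesis) {ε : ℝ} (hε : 0 < ε) :
    ∃ C : ℝ, 0 < C ∧ ∀ (q : ℕ) (χ : DirichletCharacter ℂ q), q ≠ 0 → χ ≠ 1 →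
      ∀ (y : ℕ) (s : ℂ), 1 / 2 + ε ≤ s.re → ‖smoothLC χ s y‖ ≤ C * ((q : ℝ) * (1 + |s.im|)) ^ ε := by
  classical
  obtain ⟨B, hB0, hB⟩ := exists_norm_twistedPi_le
  obtain ⟨P, hP0, hP⟩ := sum_primeFactors_rpow_le (δ := ε / 4) (by positivity)
  -- the cutoff `U`: `B (2 + 2/ε) U^{-ε} ≤ ε/4`
  set M : ℝ := 4 * B * (2 + 2 / ε) / ε with hM
  have hM0 : 0 < M := by positivity
  set U : ℕ := ⌈M ^ (1 / ε)⌉₊ + 2 with hU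
  have hU2 : 2 ≤ U := by omega
  have hUM : M ^ (1 / ε) ≤ U := by rw [hU]; push_cast; linarith [Nat.le_ceil (M ^ (1 / ε))]
  have hU0 : (0 : ℝ) < U := by positivity
  have hUε : B * (2 + 2 / ε) * (U : ℝ) ^ (-ε) ≤ ε / 4 := by
    have h1 : (U : ℝ) ^ (-ε) ≤ (M ^ (1 / ε)) ^ (-ε) :=
      Real.rpow_le_rpow_of_nonpos (Real.rpow_pos_of_pos hM0 _) hUM (by linarith)
    have h2 : (M ^ (1 / ε)) ^ (-ε) = M⁻¹ := by
      rw [← Real.rpow_mul hM0.le, show 1 / ε * -ε = -1 by field_simp, Real.rpow_neg_one]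
    rw [h2] at h1
    calc B * (2 + 2 / ε) * (U : ℝ) ^ (-ε) ≤ B * (2 + 2 / ε) * M⁻¹ :=
          mul_le_mul_of_nonneg_left h1 (by positivity)
      _ = ε / 4 := by rw [hM]; field_simp
  -- the constant
  set K₀ : ℝ := (U : ℝ) + 1 + B * (2 / ε + 8 / ε ^ 2) + P + 1 with hK₀
  have hK₀0 : 1 ≤ K₀ := by
    have : 0 ≤ B * (2 / ε + 8 / ε ^ 2) := by positivity
    rw [hK₀]; linarith
  set C₀ : ℝ := K₀ + 6 / ε with hC₀
  refine ⟨Real.exp C₀ * (2 : ℝ) ^ (ε / 2), by positivity, fun q χ hq hχ y s hs ↦ ?_⟩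
  haveI : NeZero q := ⟨hq⟩
  set σ : ℝ := s.re with hσ
  set t : ℝ := s.im with ht
  have hσ12 : 1 / 2 ≤ σ := by linarith
  have hσ0 : 0 ≤ σ := by linarith
  have hsdecomp : s = σ + t * I := by rw [hσ, ht]; exact (Complex.re_add_im s).symm
  -- the primitive character inducing `χ`
  set d := χ.conductor with hd
  haveI : NeZero d := ⟨χ.conductor_ne_zero⟩
  have hd1 : d ≠ 1 := fun h ↦ hχ ((DirichletCharacter.eq_one_iff_conductor_eq_one (χ := χ)).2 h)
  have hdgt : 1 < d := by have := NeZero.ne d; omega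
  have hdq : d ≤ q := Nat.le_of_dvd (Nat.pos_of_ne_zero hq) χ.conductor_dvd_level
  have hprim : χ.primitiveCharacter.IsPrimitive := DirichletCharacter.primitiveCharacter_isPrimitive χ
  have hRH : χ.primitiveCharacter.RiemannHypothesis := hGRH.dirichletCharacter _
  -- sizes
  have ht0 : 0 ≤ |t| := abs_nonneg t
  have hq1 : (1 : ℝ) ≤ q := by exact_mod_cast Nat.one_le_iff_ne_zero.2 hq
  have hd2 : (2 : ℝ) ≤ d := by exact_mod_cast hdgt
  have hdq' : (d : ℝ) ≤ q := by exact_mod_cast hdq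
  have hq2 : (2 : ℝ) ≤ q := hd2.trans hdq'
  set L₀ : ℝ := Real.log (q * (|t| + 2)) with hL₀
  have hqt1 : (1 : ℝ) ≤ q * (|t| + 2) := one_le_mul_of_one_le_of_one_le hq1 (by linarith)
  have hL₀0 : 0 ≤ L₀ := Real.log_nonneg hqt1
  have hlogq : 0 ≤ Real.log q := Real.log_nonneg hq1
  have hlogqL : Real.log q ≤ L₀ :=
    Real.log_le_log (by positivity) (le_mul_of_one_le_right (by positivity) (by linarith))
  have hprimes : ∀ p ∈ Nat.primesLE y, p.Prime := fun p hp ↦ (Nat.mem_primesLE.1 hp).2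
  -- Step 1: the prime sum `‖∑_{p ≤ y} χ(p) p^{-s}‖ ≤ (ε/2) L₀ + K₀`
  have hmain : ‖∑ p ∈ Nat.primesLE y, χ (p : ZMod q) * (p : ℂ) ^ (-s)‖ ≤ ε / 2 * L₀ + K₀ := by
    rcases lt_or_ge 2 σ with hσ2 | hσ2
    · -- `σ > 2`: trivially `≤ ∑ p^{-2} ≤ 1`
      calc ‖∑ p ∈ Nat.primesLE y, χ (p : ZMod q) * (p : ℂ) ^ (-s)‖
          ≤ ∑ p ∈ Nat.primesLE y, ‖χ (p : ZMod q) * (p : ℂ) ^ (-s)‖ := norm_sum_le _ _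
        _ ≤ ∑ p ∈ Nat.primesLE y, (p : ℝ) ^ (-(2 : ℝ)) := by
            refine Finset.sum_le_sum fun p hp ↦ ?_
            have hpp := hprimes p hp
            rw [norm_mul, Complex.norm_natCast_cpow_of_pos hpp.pos, neg_re]
            calc _ ≤ 1 * (p : ℝ) ^ (-s.re) :=
                  mul_le_mul_of_nonneg_right (χ.norm_le_one _) (Real.rpow_nonneg (Nat.cast_nonneg p) _)
              _ ≤ (p : ℝ) ^ (-(2 : ℝ)) := by
                  rw [one_mul]
                  exact Real.rpow_le_rpow_of_exponent_le (by exact_mod_cast hpp.one_lt.le) (by linarith)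
        _ ≤ 1 / 1 := sum_primesLE_rpow_le one_pos (by norm_num) y
        _ ≤ ε / 2 * L₀ + K₀ := by
            have : 0 ≤ ε / 2 * L₀ := by positivity
            linarith
    · -- `σ ≤ 2`: GRH for the primitive character
      have h1 : ‖∑ p ∈ Nat.primesLE y, χ (p : ZMod q) * (p : ℂ) ^ (-s) -
          ∑ p ∈ Nat.primesLE y, χ.primitiveCharacter (p : ZMod d) * (p : ℂ) ^ (-s)‖ ≤
          ε / 4 * Real.log q + P :=
        (norm_primeSum_sub_primitive_le χ (by linarith) hprimes).trans (hP q hq)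
      have h2 : ‖∑ p ∈ Nat.primesLE y, χ.primitiveCharacter (p : ZMod d) * (p : ℂ) ^ (-s)‖ ≤
          ((U : ℝ) + 1) + (ε / 4 * L₀ + B * (2 / ε + 8 / ε ^ 2)) := by
        have hextra : 0 ≤ ε / 4 * L₀ + B * (2 / ε + 8 / ε ^ 2) := by positivity
        rw [Nat.primesLE_eq_filter_range, Nat.range_succ_eq_Icc_zero]
        rcases le_or_gt y U with hyU | hyU
        · have h := norm_sum_primes_le_card χ.primitiveCharacter (s := s) (by linarith) y
          have : (y : ℝ) ≤ U := by exact_mod_cast hyU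
          linarith
        · -- split at `U`
          have hunion : (Finset.Icc 0 y).filter Nat.Prime =
              (Finset.Icc 0 U).filter Nat.Prime ∪ (Finset.Ioc U y).filter Nat.Prime := by
            rw [← Finset.filter_union]
            congr 1
            ext p; simp [Finset.mem_Icc, Finset.mem_Ioc]; omega
          have hdisj : Disjoint ((Finset.Icc 0 U).filter Nat.Prime) ((Finset.Ioc U y).filter Nat.Prime) := by
            rw [Finset.disjoint_left]
            intro p hp1 hp2
            have a := (Finset.mem_Icc.1 (Finset.mem_filter.1 hp1).1).2
            have b := (Finset.mem_Ioc.1 (Finset.mem_filter.1 hp2).1).1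
            omega
          rw [hunion, Finset.sum_union hdisj]
          -- the primes `≤ U`
          have hsmall := norm_sum_primes_le_card χ.primitiveCharacter (s := s) (by linarith) U
          -- the primes `> U`: `p^{-s} = p^{-it} · p^{-σ}` and the second partial summation
          have hterm : ∀ p ∈ (Finset.Ioc U y).filter Nat.Prime,
              χ.primitiveCharacter (p : ZMod d) * (p : ℂ) ^ (-s) =
                χ.primitiveCharacter (p : ZMod d) * (p : ℂ) ^ (-(t * I)) * (((p : ℝ) ^ (-σ) : ℝ) : ℂ) := by
            intro p hp
            have hpp := (Finset.mem_filter.1 hp).2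
            have hp0 : (p : ℂ) ≠ 0 := by exact_mod_cast hpp.ne_zero
            rw [hsdecomp, show -((σ : ℂ) + t * I) = -(t * I) + -(σ : ℂ) by ring, Complex.cpow_add _ _ hp0,
              Complex.ofReal_cpow (Nat.cast_nonneg p) (-σ)]
            push_cast
            ring
          rw [Finset.sum_congr rfl hterm]
          have hr : (1 : ℝ) ≤ d * (|t| + 2) := one_le_mul_of_one_le_of_one_le (by linarith) (by linarith)
          have hA : ∀ N : ℕ, ‖∑ p ∈ (Finset.Icc 0 N).filter Nat.Prime,
              χ.primitiveCharacter (p : ZMod d) * (p : ℂ) ^ (-(t * I))‖ ≤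
              B * Real.sqrt N * Real.log (d * (|t| + 2) * N) := fun N ↦ hB d χ.primitiveCharacter hprim hdgt hRH t N
          have h := norm_sum_Ioc_prime_mul_rpow_le (a := fun p ↦ χ.primitiveCharacter (p : ZMod d) * (p : ℂ) ^ (-(t * I)))
            hB0.le hr hε hs hA hU2 hyU.le
          -- the bound of `h`: `log(d(|t|+2)) ≤ L₀`, `σ ≤ 2`
          have hlogr : Real.log (d * (|t| + 2)) ≤ L₀ :=
            Real.log_le_log (by positivity) (mul_le_mul_of_nonneg_right hdq' (by linarith))
          have hlogr0 : 0 ≤ Real.log (d * (|t| + 2)) := Real.log_nonneg hr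
          have hUpow : 0 ≤ (U : ℝ) ^ (-ε) := Real.rpow_nonneg hU0.le _
          have hb1 : B * Real.log (d * (|t| + 2)) * (U : ℝ) ^ (-ε) * (2 + σ / ε) ≤ ε / 4 * L₀ := by
            have hσε : 2 + σ / ε ≤ 2 + 2 / ε := by
              have := div_le_div_of_nonneg_right hσ2 hε.le; linarith
            calc B * Real.log (d * (|t| + 2)) * (U : ℝ) ^ (-ε) * (2 + σ / ε)
                ≤ B * L₀ * (U : ℝ) ^ (-ε) * (2 + 2 / ε) := by
                  refine mul_le_mul ?_ hσε (by positivity) (by positivity)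
                  exact mul_le_mul_of_nonneg_right (mul_le_mul_of_nonneg_left hlogr hB0.le) hUpow
              _ = L₀ * (B * (2 + 2 / ε) * (U : ℝ) ^ (-ε)) := by ring
              _ ≤ L₀ * (ε / 4) := mul_le_mul_of_nonneg_left hUε hL₀0
              _ = ε / 4 * L₀ := by ring
          have hb2 : B * (2 / ε + 4 * σ / ε ^ 2) ≤ B * (2 / ε + 8 / ε ^ 2) := by
            refine mul_le_mul_of_nonneg_left ?_ hB0.le
            have : 4 * σ / ε ^ 2 ≤ 8 / ε ^ 2 := div_le_div_of_nonneg_right (by linarith) (by positivity)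
            linarith
          have e := norm_add_le (∑ p ∈ (Finset.Icc 0 U).filter Nat.Prime,
              χ.primitiveCharacter (p : ZMod d) * (p : ℂ) ^ (-s))
            (∑ p ∈ (Finset.Ioc U y).filter Nat.Prime,
              χ.primitiveCharacter (p : ZMod d) * (p : ℂ) ^ (-(t * I)) * (((p : ℝ) ^ (-σ) : ℝ) : ℂ))
          linarith
      have e := norm_sub_le
        (∑ p ∈ Nat.primesLE y, χ (p : ZMod q) * (p : ℂ) ^ (-s) -
          ∑ p ∈ Nat.primesLE y, χ.primitiveCharacter (p : ZMod d) * (p : ℂ) ^ (-s))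
        (-(∑ p ∈ Nat.primesLE y, χ.primitiveCharacter (p : ZMod d) * (p : ℂ) ^ (-s)))
      rw [sub_neg_eq_add, sub_add_cancel, norm_neg] at e
      have hεq : ε / 4 * Real.log q ≤ ε / 4 * L₀ := mul_le_mul_of_nonneg_left hlogqL (by positivity)
      rw [hK₀]
      linarith
  -- Step 2: the Euler product
  have hE := norm_smoothLC_le_exp χ (s := s) (by linarith) y
  have hsq : 12 * ∑ p ∈ Nat.primesLE y, (p : ℝ) ^ (-(2 * s.re)) ≤ 6 / ε := by
    have h := sum_primesLE_rpow_le (a := 2 * ε) (b := 2 * s.re) (by positivity) (by linarith) y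
    calc 12 * ∑ p ∈ Nat.primesLE y, (p : ℝ) ^ (-(2 * s.re)) ≤ 12 * (1 / (2 * ε)) :=
          mul_le_mul_of_nonneg_left h (by norm_num)
      _ = 6 / ε := by field_simp; ring
  have hL : ‖smoothLC χ s y‖ ≤ Real.exp (ε / 2 * L₀ + C₀) :=
    hE.trans (Real.exp_le_exp.2 (by rw [hC₀]; linarith))
  -- Step 3: `exp((ε/2) L₀ + C₀) = e^{C₀} (q(|t|+2))^{ε/2} ≤ e^{C₀} 2^{ε/2} (q(1+|t|))^ε`
  have hexp : Real.exp (ε / 2 * L₀ + C₀) = Real.exp C₀ * ((q : ℝ) * (|t| + 2)) ^ (ε / 2) := by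
    rw [Real.exp_add, hL₀, Real.rpow_def_of_pos (by positivity), mul_comm (Real.log _)]
    ring
  have hbase : ((q : ℝ) * (|t| + 2)) ^ (ε / 2) ≤ (2 : ℝ) ^ (ε / 2) * ((q : ℝ) * (1 + |t|)) ^ ε := by
    have h1 : (q : ℝ) * (|t| + 2) ≤ 2 * ((q : ℝ) * (1 + |t|)) := by nlinarith
    have h2 : ((q : ℝ) * (|t| + 2)) ^ (ε / 2) ≤ (2 * ((q : ℝ) * (1 + |t|))) ^ (ε / 2) :=
      Real.rpow_le_rpow (by positivity) h1 (by positivity)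
    have h2' : (2 * ((q : ℝ) * (1 + |t|))) ^ (ε / 2) = (2 : ℝ) ^ (ε / 2) * ((q : ℝ) * (1 + |t|)) ^ (ε / 2) :=
      Real.mul_rpow (by norm_num) (by positivity)
    have h3 : ((q : ℝ) * (1 + |t|)) ^ (ε / 2) ≤ ((q : ℝ) * (1 + |t|)) ^ ε :=
      Real.rpow_le_rpow_of_exponent_le (one_le_mul_of_one_le_of_one_le hq1 (by linarith)) (by linarith)
    calc _ ≤ (2 * ((q : ℝ) * (1 + |t|))) ^ (ε / 2) := h2
      _ = (2 : ℝ) ^ (ε / 2) * ((q : ℝ) * (1 + |t|)) ^ (ε / 2) := h2'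
      _ ≤ (2 : ℝ) ^ (ε / 2) * ((q : ℝ) * (1 + |t|)) ^ ε := mul_le_mul_of_nonneg_left h3 (by positivity)
  calc ‖smoothLC χ s y‖ ≤ Real.exp (ε / 2 * L₀ + C₀) := hL
    _ = Real.exp C₀ * ((q : ℝ) * (|t| + 2)) ^ (ε / 2) := hexp
    _ ≤ Real.exp C₀ * ((2 : ℝ) ^ (ε / 2) * ((q : ℝ) * (1 + |t|)) ^ ε) :=
        mul_le_mul_of_nonneg_left hbase (Real.exp_pos _).le
    _ = Real.exp C₀ * (2 : ℝ) ^ (ε / 2) * ((q : ℝ) * (1 + |t|)) ^ ε := by ring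

end GRHSmoothEulerProduct

end Literature.NumberTheory.LFunctions
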